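import Summits.Parity.GeneralizedHardyLittlewood.Theses.LiouvilleShiftedTables
import Summits.Parity.GeneralizedHardyLittlewood.Theorems.TableChowla.Negative.TableChowlaCornerTools

/-!
# `TableChowla` (stmt-Parity-14270): corner (local box) domination by a double van der Corput

Support lemma for the crux `LiouvilleShiftedTables.TableChowla` (cdisprove seat):
`corner_domination` — for `|f| ≤ 1`, windows `H, K ≥ 1` and a bound `Mx ≥ 0` on the RESTRICTED
corner sums `cornerRes … h k` at all positive gaps `h < H`, `k < K`,
`H²K²·T ≤ (A₂+H−1−A₁)(B+K−1)·(2·N·B·H·K² + 4·N·B·H²·K + 4·H²·K²·Mx)` (`N` = number of rows):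
van der Corput across the rows (`vdC_pointwise` of `TableChowlaBandReduction`), then across the
columns inside each weighted row pair, symmetric collapse of both pair sums, and regrouping of
the off-axes part by the gaps `(h,k)`; the axes are the two diagonal terms. [folklore]
-/

namespace Summit.Parity.GeneralizedHardyLittlewood.Theorems.TableChowla.Negative

open Finset Real ArithmeticFunction
open Summit.Parity.GeneralizedHardyLittlewood.Theses

noncomputable section

variable {f : ℕ → ℝ} {c : ℤ} {A₁ A₂ B : ℕ}

/-- **CORNER (LOCAL BOX) DOMINATION.** For `|f| ≤ 1`, windows `H, K ≥ 1` and a bound `Mx` on the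
restricted corner sums at all positive gaps `h < H`, `k < K`:
`H²K²·T ≤ (A₂+H−1−A₁)(B+K−1)·(2·N·B·H·K² + 4·N·B·H²·K + 4·H²·K²·Mx)` (`N` = number of rows). -/
theorem corner_domination (hf : ∀ n, |f n| ≤ 1) {H K : ℕ} (hH : 1 ≤ H) (hK : 1 ≤ K) {Mx : ℝ} (hMx0 : 0 ≤ Mx)
    (hMx : ∀ h ∈ Finset.Ico 1 H, ∀ k ∈ Finset.Ico 1 K, |cornerRes f c A₁ A₂ B h k| ≤ Mx) :
    ((H : ℝ) ^ 2 * (K : ℝ) ^ 2) * momentN f c A₁ A₂ B ≤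
      ((A₂ + H - 1 - A₁ : ℕ) : ℝ) * ((B + K - 1 : ℕ) : ℝ) *
        (2 * (Ioc A₁ A₂).card * B * H * (K : ℝ) ^ 2 + 4 * (Ioc A₁ A₂).card * B * (H : ℝ) ^ 2 * K +
          4 * (H : ℝ) ^ 2 * (K : ℝ) ^ 2 * Mx) := by
  set I : Finset ℕ := Ioc A₁ A₂ with hI
  set J : Finset ℕ := Icc 1 B with hJ
  set M : Finset ℕ := Icc (A₁ + 1) (A₂ + H - 1) with hM
  set M' : Finset ℕ := Icc 1 (B + K - 1) with hM'
  have hIM : ∀ a ∈ I, ∀ m, a ≤ m → m < a + H → m ∈ M := by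
    intro a ha m h1 h2; rw [hI, mem_Ioc] at ha; rw [hM, mem_Icc]; omega
  have hJM : ∀ b ∈ J, ∀ m, b ≤ m → m < b + K → m ∈ M' := by
    intro b hb m h1 h2; rw [hJ, mem_Icc] at hb; rw [hM', mem_Icc]; omega
  have hMcard : (M.card : ℝ) = ((A₂ + H - 1 - A₁ : ℕ) : ℝ) := by rw [hM, Nat.card_Icc]; congr 1; omega
  have hM'card : (M'.card : ℝ) = ((B + K - 1 : ℕ) : ℝ) := by rw [hM', Nat.card_Icc, Nat.add_sub_cancel]
  have hJcard : (J.card : ℝ) = B := by rw [hJ, Nat.card_Icc, Nat.add_sub_cancel]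
  set e : ℕ → ℕ → ℝ := fun a b => f (Int.toNat ((a : ℤ) * b + c)) with he
  have habs_e : ∀ a b, |e a b| ≤ 1 := fun a b => hf _
  -- inner (column) weighted sums
  set inner : ℕ → ℕ → ℝ := fun a a' => ∑ b ∈ J, ∑ b' ∈ J, overlapW M' K b b' * boxProd f c a a' b b' with hinner
  -- Step 1 (rows): H² T ≤ |M| Σ w S²
  have step1 : (H : ℝ) ^ 2 * momentN f c A₁ A₂ B ≤
      (M.card : ℝ) * ∑ a ∈ I, ∑ a' ∈ I, overlapW M H a a' * rowCorr f c B a a' ^ 2 := by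
    have hpt : ∀ b b' : ℕ, (H : ℝ) ^ 2 * (∑ a ∈ I, e a b * e a b') ^ 2 ≤
        (M.card : ℝ) * ∑ a ∈ I, ∑ a' ∈ I, (e a b * e a b') * (e a' b * e a' b') * overlapW M H a a' :=
      fun b b' => vdC_pointwise (fun a => e a b * e a b') hIM
    have hT : momentN f c A₁ A₂ B = ∑ b ∈ Icc 1 B, ∑ b' ∈ Icc 1 B, (∑ a ∈ I, e a b * e a b') ^ 2 := by
      rw [momentN_eq_colMoment]
    rw [hT, mul_sum]
    simp_rw [mul_sum (s := Icc 1 B) (a := (H : ℝ) ^ 2)]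
    calc ∑ b ∈ Icc 1 B, ∑ b' ∈ Icc 1 B, (H : ℝ) ^ 2 * (∑ a ∈ I, e a b * e a b') ^ 2
        ≤ ∑ b ∈ Icc 1 B, ∑ b' ∈ Icc 1 B,
            (M.card : ℝ) * ∑ a ∈ I, ∑ a' ∈ I, (e a b * e a b') * (e a' b * e a' b') * overlapW M H a a' :=
          sum_le_sum fun b _ => sum_le_sum fun b' _ => hpt b b'
      _ = (M.card : ℝ) * ∑ a ∈ I, ∑ a' ∈ I, overlapW M H a a' * rowCorr f c B a a' ^ 2 := by
          rw [mul_sum]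
          simp_rw [mul_sum (a := (M.card : ℝ))]
          simp_rw [sum_comm (s := Icc 1 B) (t := I)]
          refine sum_congr rfl fun a _ => sum_congr rfl fun a' _ => ?_
          simp_rw [← mul_sum]
          congr 1
          unfold rowCorr
          rw [sq, sum_mul_sum, mul_sum]
          refine sum_congr rfl fun b _ => ?_
          rw [mul_sum]
          refine sum_congr rfl fun b' _ => ?_
          simp only [he]
          ring
  -- Step 2 (columns): K² S(a,a')² ≤ |M'| inner(a,a')
  have step2 : ∀ a a' : ℕ, (K : ℝ) ^ 2 * rowCorr f c B a a' ^ 2 ≤ (M'.card : ℝ) * inner a a' := by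
    intro a a'
    have hv := vdC_pointwise (I := J) (M := M') (H := K) (fun b => e a b * e a' b) hJM
    have hS : rowCorr f c B a a' = ∑ b ∈ J, e a b * e a' b := by unfold rowCorr; rfl
    rw [hS]
    refine le_trans hv (le_of_eq ?_)
    simp only [hinner]
    congr 1
    refine sum_congr rfl fun b _ => sum_congr rfl fun b' _ => ?_
    simp only [overlapW, boxProd, he]
    ring
  -- Combine: H²K² T ≤ |M||M'| Q
  set Q : ℝ := ∑ a ∈ I, ∑ a' ∈ I, overlapW M H a a' * inner a a' with hQ
  have e1 : (K : ℝ) ^ 2 * ((M.card : ℝ) * ∑ a ∈ I, ∑ a' ∈ I, overlapW M H a a' * rowCorr f c B a a' ^ 2) =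
      (M.card : ℝ) * ∑ a ∈ I, ∑ a' ∈ I, overlapW M H a a' * ((K : ℝ) ^ 2 * rowCorr f c B a a' ^ 2) := by
    rw [mul_left_comm, Finset.mul_sum]
    congr 1
    refine sum_congr rfl fun a _ => ?_
    rw [Finset.mul_sum]
    refine sum_congr rfl fun a' _ => ?_
    ring
  have e2 : (M.card : ℝ) * ∑ a ∈ I, ∑ a' ∈ I, overlapW M H a a' * ((M'.card : ℝ) * inner a a') =
      (M.card : ℝ) * (M'.card : ℝ) * Q := by
    have hin : ∑ a ∈ I, ∑ a' ∈ I, overlapW M H a a' * ((M'.card : ℝ) * inner a a') =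
        (M'.card : ℝ) * ∑ a ∈ I, ∑ a' ∈ I, overlapW M H a a' * inner a a' := by
      rw [Finset.mul_sum]
      refine sum_congr rfl fun a _ => ?_
      rw [Finset.mul_sum]
      refine sum_congr rfl fun a' _ => ?_
      ring
    rw [hin, hQ]
    ring
  have hcomb : ((H : ℝ) ^ 2 * (K : ℝ) ^ 2) * momentN f c A₁ A₂ B ≤ (M.card : ℝ) * (M'.card : ℝ) * Q := by
    calc ((H : ℝ) ^ 2 * (K : ℝ) ^ 2) * momentN f c A₁ A₂ B = (K : ℝ) ^ 2 * ((H : ℝ) ^ 2 * momentN f c A₁ A₂ B) := by ring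
      _ ≤ (K : ℝ) ^ 2 * ((M.card : ℝ) * ∑ a ∈ I, ∑ a' ∈ I, overlapW M H a a' * rowCorr f c B a a' ^ 2) :=
          mul_le_mul_of_nonneg_left step1 (by positivity)
      _ = (M.card : ℝ) * ∑ a ∈ I, ∑ a' ∈ I, overlapW M H a a' * ((K : ℝ) ^ 2 * rowCorr f c B a a' ^ 2) := e1
      _ ≤ (M.card : ℝ) * ∑ a ∈ I, ∑ a' ∈ I, overlapW M H a a' * ((M'.card : ℝ) * inner a a') := by
          apply mul_le_mul_of_nonneg_left _ (Nat.cast_nonneg _)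
          exact sum_le_sum fun a _ => sum_le_sum fun a' _ =>
            mul_le_mul_of_nonneg_left (step2 a a') (overlapW_nonneg _ _ _ _)
      _ = (M.card : ℝ) * (M'.card : ℝ) * Q := e2
  -- Symmetric collapse in the rows: Q = D_a + 2 U
  have hGsymm : ∀ a a', overlapW M H a a' * inner a a' = overlapW M H a' a * inner a' a := by
    intro a a'
    rw [overlapW_symm]
    simp only [hinner]
    congr 1
    exact sum_congr rfl fun b _ => sum_congr rfl fun b' _ => by rw [boxProd_symm_rows]
  have hQsplit := sum_pairs_symm I (fun a a' => overlapW M H a a' * inner a a') hGsymm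
  -- Symmetric collapse in the columns: inner a a' = D_b a a' + 2 U_b a a'
  have hinner_symm : ∀ a a' b b', overlapW M' K b b' * boxProd f c a a' b b' = overlapW M' K b' b * boxProd f c a a' b' b := by
    intro a a' b b'; rw [overlapW_symm, boxProd_symm_cols]
  have hinner_split : ∀ a a', inner a a' = ∑ b ∈ J, overlapW M' K b b * boxProd f c a a' b b +
      2 * ∑ b ∈ J, ∑ b' ∈ J.filter (fun b' => b < b'), overlapW M' K b b' * boxProd f c a a' b b' := by
    intro a a'
    simp only [hinner]
    exact sum_pairs_symm J (fun b b' => overlapW M' K b b' * boxProd f c a a' b b') (hinner_symm a a')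
  -- (i) the row-diagonal part
  have hDa : |∑ a ∈ I, overlapW M H a a * inner a a| ≤ 2 * (I.card : ℝ) * B * H * (K : ℝ) ^ 2 := by
    calc |∑ a ∈ I, overlapW M H a a * inner a a| ≤ ∑ a ∈ I, |overlapW M H a a * inner a a| := abs_sum_le_sum_abs _ _
      _ ≤ ∑ _a ∈ I, (H : ℝ) * (B * (2 * (K : ℝ) ^ 2)) := by
          refine sum_le_sum fun a ha => ?_
          rw [abs_mul, abs_of_nonneg (overlapW_nonneg _ _ _ _)]
          have hw : overlapW M H a a ≤ H := by
            unfold overlapW; exact_mod_cast card_overlap_le (hIM a ha)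
          have hin : |inner a a| ≤ B * (2 * (K : ℝ) ^ 2) := by
            simp only [hinner]
            calc |∑ b ∈ J, ∑ b' ∈ J, overlapW M' K b b' * boxProd f c a a b b'|
                ≤ ∑ b ∈ J, |∑ b' ∈ J, overlapW M' K b b' * boxProd f c a a b b'| := abs_sum_le_sum_abs _ _
              _ ≤ ∑ b ∈ J, ∑ b' ∈ J, overlapW M' K b b' := by
                  refine sum_le_sum fun b _ => le_trans (abs_sum_le_sum_abs _ _) (sum_le_sum fun b' _ => ?_)
                  rw [abs_mul, abs_of_nonneg (overlapW_nonneg _ _ _ _)]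
                  exact mul_le_of_le_one_right (overlapW_nonneg _ _ _ _) (abs_boxProd_le hf _ _ _ _)
              _ ≤ ∑ _b ∈ J, 2 * (K : ℝ) ^ 2 := sum_le_sum fun b hb => by
                  unfold overlapW; exact sum_overlap_le J b (hJM b hb)
              _ = B * (2 * (K : ℝ) ^ 2) := by rw [sum_const, nsmul_eq_mul, hJcard]
          exact mul_le_mul hw hin (abs_nonneg _) (Nat.cast_nonneg _)
      _ = 2 * (I.card : ℝ) * B * H * (K : ℝ) ^ 2 := by rw [sum_const, nsmul_eq_mul]; ring
  -- (ii) the column-diagonal inside the strict upper row pairs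
  have hDb : |∑ a ∈ I, ∑ a' ∈ I.filter (fun a' => a < a'),
      overlapW M H a a' * ∑ b ∈ J, overlapW M' K b b * boxProd f c a a' b b| ≤
      2 * (I.card : ℝ) * B * (H : ℝ) ^ 2 * K := by
    calc |∑ a ∈ I, ∑ a' ∈ I.filter (fun a' => a < a'), overlapW M H a a' * ∑ b ∈ J, overlapW M' K b b * boxProd f c a a' b b|
        ≤ ∑ a ∈ I, ∑ a' ∈ I.filter (fun a' => a < a'), |overlapW M H a a' * ∑ b ∈ J, overlapW M' K b b * boxProd f c a a' b b| :=
          le_trans (abs_sum_le_sum_abs _ _) (sum_le_sum fun a _ => abs_sum_le_sum_abs _ _)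
      _ ≤ ∑ a ∈ I, ∑ a' ∈ I.filter (fun a' => a < a'), overlapW M H a a' * (B * K) := by
          refine sum_le_sum fun a _ => sum_le_sum fun a' _ => ?_
          rw [abs_mul, abs_of_nonneg (overlapW_nonneg _ _ _ _)]
          refine mul_le_mul_of_nonneg_left ?_ (overlapW_nonneg _ _ _ _)
          calc |∑ b ∈ J, overlapW M' K b b * boxProd f c a a' b b| ≤ ∑ b ∈ J, |overlapW M' K b b * boxProd f c a a' b b| :=
                abs_sum_le_sum_abs _ _
            _ ≤ ∑ _b ∈ J, (K : ℝ) := sum_le_sum fun b hb => by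
                rw [abs_mul, abs_of_nonneg (overlapW_nonneg _ _ _ _)]
                have hw : overlapW M' K b b ≤ K := by unfold overlapW; exact_mod_cast card_overlap_le (hJM b hb)
                calc overlapW M' K b b * |boxProd f c a a' b b| ≤ overlapW M' K b b * 1 :=
                      mul_le_mul_of_nonneg_left (abs_boxProd_le hf _ _ _ _) (overlapW_nonneg _ _ _ _)
                  _ ≤ K := by rw [mul_one]; exact hw
            _ = B * K := by rw [sum_const, nsmul_eq_mul, hJcard]
      _ ≤ ∑ a ∈ I, ∑ a' ∈ I, overlapW M H a a' * (B * K) := by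
          refine sum_le_sum fun a _ => sum_le_sum_of_subset_of_nonneg (filter_subset _ _) fun _ _ _ => ?_
          exact mul_nonneg (overlapW_nonneg _ _ _ _) (by positivity)
      _ ≤ ∑ _a ∈ I, 2 * (H : ℝ) ^ 2 * (B * K) := by
          refine sum_le_sum fun a ha => ?_
          rw [← sum_mul]
          apply mul_le_mul_of_nonneg_right _ (by positivity)
          unfold overlapW; exact sum_overlap_le I a (hIM a ha)
      _ = 2 * (I.card : ℝ) * B * (H : ℝ) ^ 2 * K := by rw [sum_const, nsmul_eq_mul]; ring
  -- (iii) the off-axes part = Σ_{h,k} (H−h)(K−k) 𝒞(h,k)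
  have hV : ∑ a ∈ I, ∑ a' ∈ I.filter (fun a' => a < a'),
      overlapW M H a a' * ∑ b ∈ J, ∑ b' ∈ J.filter (fun b' => b < b'), overlapW M' K b b' * boxProd f c a a' b b' =
      ∑ h ∈ Finset.Ico 1 H, ∑ k ∈ Finset.Ico 1 K, ((H - h : ℕ) : ℝ) * ((K - k : ℕ) : ℝ) * cornerRes f c A₁ A₂ B h k := by
    -- rows: vanish beyond the window, regroup by h, exact weight H − h
    rw [sum_upper_window I _ H (fun a _ a' _ hfar => by
      rw [show overlapW M H a a' = 0 by
        unfold overlapW; rw [card_overlap_eq_zero (by omega), Nat.cast_zero], zero_mul])]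
    have hrow : ∀ a ∈ I, ∀ h ∈ (Finset.Ico 1 H).filter (fun h => a + h ∈ I),
        overlapW M H a (a + h) = ((H - h : ℕ) : ℝ) := by
      intro a ha h hh
      rw [mem_filter, Finset.mem_Ico] at hh
      unfold overlapW
      rw [card_overlap_eq (hIM a ha) hh.1.2]
    rw [sum_congr rfl fun a ha => sum_congr rfl fun h hh => by rw [hrow a ha h hh]]
    -- columns: same, inside
    have hcol : ∀ a a' : ℕ, ∑ b ∈ J, ∑ b' ∈ J.filter (fun b' => b < b'), overlapW M' K b b' * boxProd f c a a' b b' =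
        ∑ b ∈ J, ∑ k ∈ (Finset.Ico 1 K).filter (fun k => b + k ∈ J), ((K - k : ℕ) : ℝ) * boxProd f c a a' b (b + k) := by
      intro a a'
      rw [sum_upper_window J _ K (fun b _ b' _ hfar => by
        rw [show overlapW M' K b b' = 0 by
          unfold overlapW; rw [card_overlap_eq_zero (by omega), Nat.cast_zero], zero_mul])]
      refine sum_congr rfl fun b hb => sum_congr rfl fun k hk => ?_
      rw [mem_filter, Finset.mem_Ico] at hk
      unfold overlapW
      rw [card_overlap_eq (hJM b hb) hk.1.2]
    simp_rw [hcol]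
    -- now swap: Σ_a Σ_h[filter] Σ_b Σ_k[filter] → Σ_h Σ_k Σ_a[filter] Σ_b[filter]
    rw [sum_filter_comm I (Finset.Ico 1 H)]
    refine sum_congr rfl fun h _ => ?_
    simp_rw [mul_sum]
    rw [sum_comm]
    -- goal: Σ_b∈J Σ_{a ∈ I.filter} Σ_{k ∈ filter} (H-h) * ((K-k) * box) = Σ_k (H-h)(K-k) cornerRes h k
    have : ∀ b ∈ J, ∑ a ∈ I.filter (fun a => a + h ∈ I), ∑ k ∈ (Finset.Ico 1 K).filter (fun k => b + k ∈ J),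
        ((H - h : ℕ) : ℝ) * (((K - k : ℕ) : ℝ) * boxProd f c a (a + h) b (b + k)) =
        ∑ k ∈ (Finset.Ico 1 K).filter (fun k => b + k ∈ J), ∑ a ∈ I.filter (fun a => a + h ∈ I),
        ((H - h : ℕ) : ℝ) * (((K - k : ℕ) : ℝ) * boxProd f c a (a + h) b (b + k)) := fun b _ => sum_comm
    rw [sum_congr rfl this, sum_filter_comm J (Finset.Ico 1 K)]
    refine sum_congr rfl fun k _ => ?_
    unfold cornerRes
    rw [← hI, ← hJ, mul_sum, sum_comm]
    refine sum_congr rfl fun a _ => ?_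
    rw [mul_sum]
    refine sum_congr rfl fun b _ => ?_
    ring
  -- bound on (iii)
  have hVbound : |∑ h ∈ Finset.Ico 1 H, ∑ k ∈ Finset.Ico 1 K, ((H - h : ℕ) : ℝ) * ((K - k : ℕ) : ℝ) * cornerRes f c A₁ A₂ B h k| ≤
      (H : ℝ) ^ 2 * (K : ℝ) ^ 2 * Mx := by
    calc |∑ h ∈ Finset.Ico 1 H, ∑ k ∈ Finset.Ico 1 K, ((H - h : ℕ) : ℝ) * ((K - k : ℕ) : ℝ) * cornerRes f c A₁ A₂ B h k|
        ≤ ∑ h ∈ Finset.Ico 1 H, ∑ k ∈ Finset.Ico 1 K, |((H - h : ℕ) : ℝ) * ((K - k : ℕ) : ℝ) * cornerRes f c A₁ A₂ B h k| :=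
          le_trans (abs_sum_le_sum_abs _ _) (sum_le_sum fun h _ => abs_sum_le_sum_abs _ _)
      _ ≤ ∑ _h ∈ Finset.Ico 1 H, ∑ _k ∈ Finset.Ico 1 K, (H : ℝ) * K * Mx := by
          refine sum_le_sum fun h hh => sum_le_sum fun k hk => ?_
          rw [abs_mul, abs_mul, abs_of_nonneg (Nat.cast_nonneg _), abs_of_nonneg (Nat.cast_nonneg _)]
          have h1 : ((H - h : ℕ) : ℝ) ≤ H := by exact_mod_cast Nat.sub_le H h
          have h2 : ((K - k : ℕ) : ℝ) ≤ K := by exact_mod_cast Nat.sub_le K k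
          have h3 := hMx h hh k hk
          have hMx0 : 0 ≤ Mx := le_trans (abs_nonneg _) h3
          exact mul_le_mul (mul_le_mul h1 h2 (Nat.cast_nonneg _) (Nat.cast_nonneg _)) h3 (abs_nonneg _) (by positivity)
      _ ≤ (H : ℝ) ^ 2 * (K : ℝ) ^ 2 * Mx := by
          rw [sum_const, sum_const, nsmul_eq_mul, nsmul_eq_mul, Nat.card_Ico, Nat.card_Ico]
          have h1 : ((H - 1 : ℕ) : ℝ) ≤ H := by exact_mod_cast Nat.sub_le H 1
          have h2 : ((K - 1 : ℕ) : ℝ) ≤ K := by exact_mod_cast Nat.sub_le K 1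
          calc ((H - 1 : ℕ) : ℝ) * (((K - 1 : ℕ) : ℝ) * ((H : ℝ) * K * Mx)) ≤ (H : ℝ) * ((K : ℝ) * ((H : ℝ) * K * Mx)) :=
                mul_le_mul h1 (mul_le_mul_of_nonneg_right h2 (by positivity)) (by positivity) (by positivity)
            _ = (H : ℝ) ^ 2 * (K : ℝ) ^ 2 * Mx := by ring
  -- assemble Q
  have hU : ∑ a ∈ I, ∑ a' ∈ I.filter (fun a' => a < a'), overlapW M H a a' * inner a a' =
      ∑ a ∈ I, ∑ a' ∈ I.filter (fun a' => a < a'), overlapW M H a a' * ∑ b ∈ J, overlapW M' K b b * boxProd f c a a' b b +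
      2 * ∑ a ∈ I, ∑ a' ∈ I.filter (fun a' => a < a'),
        overlapW M H a a' * ∑ b ∈ J, ∑ b' ∈ J.filter (fun b' => b < b'), overlapW M' K b b' * boxProd f c a a' b b' := by
    rw [mul_sum, ← sum_add_distrib]
    refine sum_congr rfl fun a _ => ?_
    rw [mul_sum, ← sum_add_distrib]
    refine sum_congr rfl fun a' _ => ?_
    rw [hinner_split]
    ring
  -- pure arithmetic on opaque reals (keeps `ring`/`linarith` away from the big sums)
  have arith : ∀ (q u v x1 x2 x3 b1 b2 b3 : ℝ), q = x1 + 2 * u → u = x2 + 2 * v → v = x3 →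
      |x1| ≤ b1 → |x2| ≤ b2 → |x3| ≤ b3 → |q| ≤ b1 + 2 * b2 + 4 * b3 := by
    intro q u v x1 x2 x3 b1 b2 b3 h1 h2 h3 h4 h5 h6
    subst h1; subst h2; subst h3
    rw [abs_le] at h4 h5 h6 ⊢
    constructor <;> linarith only [h4.1, h4.2, h5.1, h5.2, h6.1, h6.2]
  have hQbound : |Q| ≤ 2 * (I.card : ℝ) * B * H * (K : ℝ) ^ 2 + 2 * (2 * (I.card : ℝ) * B * (H : ℝ) ^ 2 * K) +
      4 * ((H : ℝ) ^ 2 * (K : ℝ) ^ 2 * Mx) :=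
    arith _ _ _ _ _ _ _ _ _ (hQ.trans hQsplit) hU hV hDa hDb hVbound
  -- finish (arithmetic on opaque reals again)
  have finish : ∀ (T m m' q i b hh kk mx : ℝ), hh ^ 2 * kk ^ 2 * T ≤ m * m' * q → 0 ≤ m → 0 ≤ m' →
      |q| ≤ 2 * i * b * hh * kk ^ 2 + 2 * (2 * i * b * hh ^ 2 * kk) + 4 * (hh ^ 2 * kk ^ 2 * mx) →
      hh ^ 2 * kk ^ 2 * T ≤ m * m' * (2 * i * b * hh * kk ^ 2 + 4 * i * b * hh ^ 2 * kk + 4 * hh ^ 2 * kk ^ 2 * mx) := by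
    intro T m m' q i b hh kk mx h1 hm hm' h2
    have h3 : q ≤ 2 * i * b * hh * kk ^ 2 + 4 * i * b * hh ^ 2 * kk + 4 * hh ^ 2 * kk ^ 2 * mx := by
      linarith only [le_abs_self q, h2]
    exact le_trans h1 (mul_le_mul_of_nonneg_left h3 (mul_nonneg hm hm'))
  have hfin := finish _ _ _ _ _ _ _ _ _ hcomb (Nat.cast_nonneg _) (Nat.cast_nonneg _) hQbound
  rw [hMcard, hM'card] at hfin
  exact hfin

end

end Summit.Parity.GeneralizedHardyLittlewood.Theorems.TableChowla.Negative
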